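import Summits.Ventures.QEC.Census.ClassicalDistCert
import Literature.InformationTheory.QuantumCodes.CSSStabilizer
import Literature.InformationTheory.QuantumCodes.ParityCheckDuality
import HarnessLib

/-!
# Zero-rate CSS census rows in the kernel: `[[n, 0, d]]` (CRSS convention) from two classical certificates

LADDER-QEC (venture cell `qec`), CENSUS-PREREG C.2 — the `k = 0` cells of the CSS calibration table
(census/search-5/css-n12/CSS-CALIB.tsv, rows `css_n<N>_k0`; qec-search-5's REPORT: «`k = 0`: CRSS convention (min
nonzero stabilizer weight `= min(d(A), d(B))`)», `A` = the span of the `X`-checks, `B` = the span of the `Z`-checks).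
The census predicate `CSSCode.IsCode` has no `k = 0` instances (`cssMinDist = ⊤`), so these rows are stated, like the
`k = 0` cells of CRSS Table III (Census/Additive/*, qec-search-5 through qec-type-02's `AdditiveCertCheck.lean`), in
CRSS's sense: `IsAdditiveCode S̄ 0 d` for the stabilizer space `S̄ = rs H^X × rs H^Z` (`CSSCode.toSympCode`,
Literature/…/CSSStabilizer.lean) — self-dual, and every NONZERO stabilizer has weight `≥ d` — together with a
stabilizer of weight exactly `d`.

The point of this file: for a CSS code with `rank H^X + rank H^Z = n` NO quantum enumeration is needed. By the rank
certificate of parity-check duality (`rowSpace_eq_pcCode_of_mul_transpose_eq_zero`, Literature/…/ParityCheckDuality.lean: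
`H^X (H^Z)ᵀ = 0` and `n ≤ rk H^X + rk H^Z` give `rs H^Z = ker H^X` and `rs H^X = ker H^Z`) the two stabilizer spans ARE
the classical codes `ker H^Z`, `ker H^X`, whose minimum distances are certified by qec-type-04's CLASSICAL distance
certificates (`minDist_pcCode_of_sideOK`, Census/ClassicalDistCert.lean: a one-sided `DistCert.sideOK n H [] s` of
qec-type-10's checker with EMPTY stabilizer list); a nonzero `(a|b) ∈ S̄` has `a ≠ 0` or `b ≠ 0`, so its weight is
`≥ min (d(ker H^Z), d(ker H^X))`, and the classical witness of the smaller side is a stabilizer of that weight.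

* `css_isAdditiveCode_zero_of_certs` — from `commOK`, two `RankCert`s with `r_X + r_Z = n` and two classical
  `SideCert`s: `IsAdditiveCode C.toSympCode 0 (min d₁ d₂) ∧ ∃ v ∈ C.toSympCode, v ≠ 0 ∧ sympWeight v = min d₁ d₂`
  for `C = CSSCode.ofMatrices (rowMatrix n HX) (rowMatrix n HZ) _` — the shape the census files `Census/CSS/*.lean`
  instantiate by `decide`;
* the pieces: `css_rowSpX_eq_kerZ_of_rank` / `css_rowSpZ_eq_kerX_of_rank` (zero rate ⇒ the spans are the kernels),
  `css_le_sympWeight_of_zero_rate` (weight bound for nonzero stabilizers), `css_hasMinDist_of_k_eq_zero`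
  (no logical operator at all when `k = 0`).

HONEST FRAMING: statements about explicit instances; tier KERNEL-std when the four certificates are closed by `decide`.
Elementary linear algebra over `𝔽₂` [folklore]; the `[[n,0,d]]` convention is CRSS 1998 §3 (printed p. 10).
-/

namespace Summit.Ventures.QEC.Census

open Matrix Literature.InformationTheory.QuantumCodes
open Literature.InformationTheory.Coding (minDist le_minDist_iff)

section Pieces

variable {n : ℕ} {RX RZ : Type*} [Fintype RX] [Fintype RZ]

/-- With `k = 0` a CSS code has no logical operator: the minimum-distance clause of `IsAdditiveCode` holds for every
`d`. [folklore] -/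
theorem css_hasMinDist_of_k_eq_zero (C : Literature.InformationTheory.QuantumCodes.CSSCode RX RZ (Fin n)) (hk : C.k = 0)
    (d : ℕ) : HasMinDist C.toSympCode d := by
  intro w hw hw'
  exfalso
  have h := (exists_logical_iff_logicalDim_pos C.isSelfOrthogonal_toSympCode).1 ⟨w, hw, hw'⟩
  rw [C.logicalDim_toSympCode, hk] at h
  exact absurd h (lt_irrefl 0)

/-- Zero rate ⇒ the `X`-stabilizer span is the whole classical code `ker H^Z`: `rs H^X = ker H^Z` when
`n ≤ rk H^X + rk H^Z` (parity-check duality rank certificate, Lean-QEC Lemma 4.1 form). [folklore] -/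
theorem css_rowSpX_eq_kerZ_of_rank (C : Literature.InformationTheory.QuantumCodes.CSSCode RX RZ (Fin n))
    (hr : n ≤ C.HX.rank + C.HZ.rank) : C.rowSpX = C.kerZ := by
  have h := rowSpace_eq_pcCode_of_mul_transpose_eq_zero C.HZ C.HX C.HZ_mul_HX_transpose
    (by rw [Fintype.card_fin]; omega)
  exact h

/-- Zero rate ⇒ `rs H^Z = ker H^X`. [folklore] -/
theorem css_rowSpZ_eq_kerX_of_rank (C : Literature.InformationTheory.QuantumCodes.CSSCode RX RZ (Fin n))
    (hr : n ≤ C.HX.rank + C.HZ.rank) : C.rowSpZ = C.kerX :=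
  rowSpace_eq_pcCode_of_mul_transpose_eq_zero C.HX C.HZ C.comm (by rw [Fintype.card_fin]; omega)

/-- **Weight bound for nonzero stabilizers of a zero-rate CSS code**: if every nonzero word of `ker H^Z` has weight
`≥ d₁` and every nonzero word of `ker H^X` has weight `≥ d₂`, then (for `n ≤ rk H^X + rk H^Z`) every nonzero
`(a|b) ∈ rs H^X × rs H^Z` has weight `≥ min d₁ d₂`. [folklore] -/
theorem css_le_sympWeight_of_zero_rate (C : Literature.InformationTheory.QuantumCodes.CSSCode RX RZ (Fin n))
    (hr : n ≤ C.HX.rank + C.HZ.rank) {d₁ d₂ : ℕ}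
    (h₁ : ∀ v : Fin n → ZMod 2, C.HZ *ᵥ v = 0 → v ≠ 0 → d₁ ≤ hammingNorm v)
    (h₂ : ∀ v : Fin n → ZMod 2, C.HX *ᵥ v = 0 → v ≠ 0 → d₂ ≤ hammingNorm v)
    {w : SympVec n} (hw : w ∈ C.toSympCode) (hw0 : w ≠ 0) : min d₁ d₂ ≤ sympWeight w := by
  obtain ⟨ha, hb⟩ := (C.mem_toSympCode_iff w).1 hw
  rw [css_rowSpX_eq_kerZ_of_rank C hr] at ha
  rw [css_rowSpZ_eq_kerX_of_rank C hr] at hb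
  by_cases h0 : w.1 = 0
  · have hb0 : w.2 ≠ 0 := fun h => hw0 (Prod.ext h0 h)
    exact (min_le_right _ _).trans ((h₂ w.2 hb hb0).trans (hammingNorm_snd_le_sympWeight w))
  · exact (min_le_left _ _).trans ((h₁ w.1 ha h0).trans (hammingNorm_fst_le_sympWeight w))

end Pieces

/-! ## The certificate form consumed by the census files -/

/-- A classical one-sided certificate (empty stabilizer list) bounds every nonzero kernel word below by `s.d` and
produces a kernel word of weight exactly `s.d`. [folklore] -/
theorem classical_of_sideOK {n : ℕ} {H : List ℕ} {s : SideCert} (h : DistCert.sideOK n H [] s = true) :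
    (∀ v : Fin n → ZMod 2, rowMatrix n H *ᵥ v = 0 → v ≠ 0 → s.d ≤ hammingNorm v) ∧
      ∃ v : Fin n → ZMod 2, rowMatrix n H *ᵥ v = 0 ∧ v ≠ 0 ∧ hammingNorm v = s.d := by
  obtain ⟨v, hv, hv', hwt, hall⟩ := sideOK_sound h
  rw [not_mem_rowSpace_nil_iff] at hv'
  refine ⟨fun w hw hw0 => hall w hw ((not_mem_rowSpace_nil_iff w).2 hw0), v, hv, hv', hwt⟩

/-- **`[[n, 0, d]]` CSS rows from certificates.** For check lists `HX`, `HZ` over `n` qubits: the commutation check,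
two rank certificates with `r_X + r_Z = n` (so `k = 0`), and two CLASSICAL distance certificates — `sX` for `ker H^Z`
(syndrome rows `HZ`, empty stabilizer list; `sX.d = d(ker H^Z)` = least weight of a nonzero `X`-stabilizer) and `sZ`
for `ker H^X` — give: the stabilizer space `S̄ = rs H^X × rs H^Z` of the CSS code of the literal rows is an
`[[n, 0, min (sX.d, sZ.d)]]` additive code in CRSS's sense (self-dual; every nonzero stabilizer has weight `≥ d`), and a
stabilizer of weight exactly `d = min (sX.d, sZ.d)` exists. All hypotheses are `decide` goals. [folklore] -/
theorem css_isAdditiveCode_zero_of_certs {n : ℕ} {HX HZ : List ℕ} (hc : commOK n HX HZ = true)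
    {cX cZ : RankCert} (hX : cX.check n HX = true) (hZ : cZ.check n HZ = true) (hr : cX.r + cZ.r = n)
    {sX sZ : SideCert} (hsX : DistCert.sideOK n HZ [] sX = true) (hsZ : DistCert.sideOK n HX [] sZ = true) :
    IsAdditiveCode
        (Literature.InformationTheory.QuantumCodes.CSSCode.ofMatrices (rowMatrix n HX) (rowMatrix n HZ)
          (comm_of_commOK hc)).toSympCode 0 (min sX.d sZ.d) ∧
      ∃ v ∈ (Literature.InformationTheory.QuantumCodes.CSSCode.ofMatrices (rowMatrix n HX) (rowMatrix n HZ)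
          (comm_of_commOK hc)).toSympCode, v ≠ 0 ∧ sympWeight v = min sX.d sZ.d := by
  set C := Literature.InformationTheory.QuantumCodes.CSSCode.ofMatrices (rowMatrix n HX) (rowMatrix n HZ)
    (comm_of_commOK hc) with hC
  have hrX : C.HX.rank = cX.r := rank_rowMatrix_of_check hX
  have hrZ : C.HZ.rank = cZ.r := rank_rowMatrix_of_check hZ
  have hrk : n ≤ C.HX.rank + C.HZ.rank := by rw [hrX, hrZ, hr]
  have hk : C.k = 0 := by rw [C.k_eq, Fintype.card_fin, hrX, hrZ]; omega
  obtain ⟨h₁, v₁, hv₁, hv₁0, hwt₁⟩ := classical_of_sideOK hsX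
  obtain ⟨h₂, v₂, hv₂, hv₂0, hwt₂⟩ := classical_of_sideOK hsZ
  have hbound : ∀ w ∈ C.toSympCode, w ≠ 0 → min sX.d sZ.d ≤ sympWeight w :=
    fun w hw hw0 => css_le_sympWeight_of_zero_rate C hrk h₁ h₂ hw hw0
  have hdim : Module.finrank (ZMod 2) C.toSympCode + 0 = n := by
    have h := C.finrank_toSympCode_add_k
    rw [hk] at h
    exact h
  refine ⟨⟨C.isSelfOrthogonal_toSympCode, hdim, css_hasMinDist_of_k_eq_zero C hk _, fun _ => hbound⟩, ?_⟩
  -- the witness: the classical witness of the smaller side, as a pure `X`- or pure `Z`-type stabilizer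
  have hmem₁ : ((v₁, 0) : SympVec n) ∈ C.toSympCode := by
    rw [C.mem_toSympCode_iff, css_rowSpX_eq_kerZ_of_rank C hrk]
    exact ⟨hv₁, Submodule.zero_mem _⟩
  have hmem₂ : ((0, v₂) : SympVec n) ∈ C.toSympCode := by
    rw [C.mem_toSympCode_iff, css_rowSpZ_eq_kerX_of_rank C hrk]
    exact ⟨Submodule.zero_mem _, hv₂⟩
  rcases le_total sX.d sZ.d with hle | hle
  · refine ⟨(v₁, 0), hmem₁, fun h => hv₁0 (congrArg Prod.fst h), ?_⟩
    rw [min_eq_left hle, sympWeight_mk_zero_snd, hwt₁]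
  · refine ⟨(0, v₂), hmem₂, fun h => hv₂0 (congrArg Prod.snd h), ?_⟩
    rw [min_eq_right hle, sympWeight_mk_zero_fst, hwt₂]

/-- **One-sided variant** (rows whose `Z`-checks have full rank `r_Z = n`, e.g. `css_n1_k0` with `H^X = []`,
`H^Z = [1]`): then `ker H^Z = 0`, so the `X`-stabilizer span `rs H^X = ker H^Z` is trivial and every nonzero stabilizer
is a pure `Z`-type element of `rs H^Z = ker H^X`, whose weight a single CLASSICAL certificate for `ker H^X` bounds; the
classical witness is a stabilizer of weight exactly `sZ.d`. All hypotheses are `decide` goals. [folklore] -/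
theorem css_isAdditiveCode_zero_of_certs_zOnly {n : ℕ} {HX HZ : List ℕ} (hc : commOK n HX HZ = true)
    {cX cZ : RankCert} (hX : cX.check n HX = true) (hZ : cZ.check n HZ = true) (hr : cX.r + cZ.r = n)
    (hfull : cZ.r = n) {sZ : SideCert} (hsZ : DistCert.sideOK n HX [] sZ = true) :
    IsAdditiveCode
        (Literature.InformationTheory.QuantumCodes.CSSCode.ofMatrices (rowMatrix n HX) (rowMatrix n HZ)
          (comm_of_commOK hc)).toSympCode 0 sZ.d ∧
      ∃ v ∈ (Literature.InformationTheory.QuantumCodes.CSSCode.ofMatrices (rowMatrix n HX) (rowMatrix n HZ)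
          (comm_of_commOK hc)).toSympCode, v ≠ 0 ∧ sympWeight v = sZ.d := by
  set C := Literature.InformationTheory.QuantumCodes.CSSCode.ofMatrices (rowMatrix n HX) (rowMatrix n HZ)
    (comm_of_commOK hc) with hC
  have hrX : C.HX.rank = cX.r := rank_rowMatrix_of_check hX
  have hrZ : C.HZ.rank = cZ.r := rank_rowMatrix_of_check hZ
  have hrk : n ≤ C.HX.rank + C.HZ.rank := by rw [hrX, hrZ, hr]
  have hk : C.k = 0 := by rw [C.k_eq, Fintype.card_fin, hrX, hrZ]; omega
  have hbot : C.kerZ = ⊥ := pcCode_eq_bot_of_rankCert hZ hfull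
  obtain ⟨h₂, v₂, hv₂, hv₂0, hwt₂⟩ := classical_of_sideOK hsZ
  have hbound : ∀ w ∈ C.toSympCode, w ≠ 0 → sZ.d ≤ sympWeight w := by
    intro w hw hw0
    obtain ⟨ha, hb⟩ := (C.mem_toSympCode_iff w).1 hw
    rw [css_rowSpX_eq_kerZ_of_rank C hrk, hbot, Submodule.mem_bot] at ha
    rw [css_rowSpZ_eq_kerX_of_rank C hrk] at hb
    have hb0 : w.2 ≠ 0 := fun h => hw0 (Prod.ext ha h)
    exact (h₂ w.2 hb hb0).trans (hammingNorm_snd_le_sympWeight w)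
  have hdim : Module.finrank (ZMod 2) C.toSympCode + 0 = n := by
    have h := C.finrank_toSympCode_add_k
    rw [hk] at h
    exact h
  refine ⟨⟨C.isSelfOrthogonal_toSympCode, hdim, css_hasMinDist_of_k_eq_zero C hk _, fun _ => hbound⟩, ?_⟩
  have hmem₂ : ((0, v₂) : SympVec n) ∈ C.toSympCode := by
    rw [C.mem_toSympCode_iff, css_rowSpZ_eq_kerX_of_rank C hrk]
    exact ⟨Submodule.zero_mem _, hv₂⟩
  exact ⟨(0, v₂), hmem₂, fun h => hv₂0 (congrArg Prod.snd h), by rw [sympWeight_mk_zero_fst, hwt₂]⟩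

end Summit.Ventures.QEC.Census
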